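import Summits.BirchSwinnertonDyer.BirchSwinnertonDyer.Theorems.OneSidedTwistSqueezeX9KatoDivisibilityX9ReciprocityPkSplitValues
import Summits.BirchSwinnertonDyer.BirchSwinnertonDyer.Theorems.SmallImageMuTransferMuTransferX9LocalQTermNaturality
import HarnessLib

set_option autoImplicit false

-- the summit and its single problem are both named `BirchSwinnertonDyer` (registry layout D-0017)
set_option linter.dupNamespace false

/-!
# Crux `KatoDivisibilityX9` (stmt-BirchSwinnertonDyer-20547), line `graded_euler_loss`, stub `stub_reciprocityPkAX9`
# (1c′, hypothesis `hLocalPk`), file C: (N3) `tr × ur` PERFECTNESS in the twist/Gorenstein currency and (N1) NATURALITY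
# of the local cup product for `e`-adjoint endomorphism pairs — LEVEL `p^k`

Seat `bsd-line-k6-p4` (prover-bsd-line-k6-p4-g6-0, 6th LEAD).  THEOREMS ONLY; no definition, no named fact, no
`sorry`; nothing is asserted about any curve; `--supports stmt-BirchSwinnertonDyer-20547` helper, closes nothing.
Verbatim level-`p^k` twin of koly's `…X9LocalQTermNaturality` (`twistModP ↦ twistModPk`, `twistDualMap ↦`
T6d `twistDualMapPk`, `μ_p ↦ μ_{p^k}`, `LocalInvariants K p ↦ LocalInvariants K (p^k)`, `p ∣ ℓ − 1 ↦ p^k ∣ ℓ − 1`;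
the generic inputs `eq_zero_of_mem_transverse_of_forall_unramified_pairing_eq_zero` (`n = p^k` odd),
`toLocal_apply_eq_self_of_split`, `X11b.LocBridge.…` are reused):
* `exists_unramified_cupProduct_ne_zero_of_transverse_pk` — a NON-ZERO transverse class of `𝒯_J^{(k)}|_q` pairs
  non-trivially with some unramified cocycle of `𝒯′_J^{(k)}|_q` (perfect `e`, `inv.IsPerfect`).
* `cupProduct_iterate_eq_of_adjoint_pk` — naturality for an `e`-adjoint pair `(φ₀, φ₀′)` of endomorphisms of `M`, `M′`
  at an `E`-split prime.

References: B. Mazur, K. Rubin, Mem. AMS 799 (2004) Prop. 1.3.2 [MazurRubin2004]; J. S. Milne, *ADT* (2006) I Cor. 2.3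
[MilneADT2006]; J. Neukirch, A. Schmidt, K. Wingberg (2008) I §4 (1.4.2) [NeukirchSchmidtWingberg2008].
-/

noncomputable section

open scoped Classical ContRepresentation

universe u

namespace Summit.BirchSwinnertonDyer.BirchSwinnertonDyer.Theorems.OneSidedTwistSqueezeX9KatoDivisibilityX9ReciprocityPkNaturality

open CategoryTheory ContinuousCohomology Function Field ValuativeRel NumberField IsDedekindDomain Finset
open Literature.NumberTheory.GaloisRepresentations
open Literature.NumberTheory.GaloisRepresentations.IsNonarchimedeanLocalField
open _root_.TopRep
open Literature.NumberTheory.GaloisCohomology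
open Literature.NumberTheory.EllipticCurves
open Summit.BirchSwinnertonDyer.Rank1Residual.GaloisImage
open Summit.BirchSwinnertonDyer.Rank1Residual (X11b.LocBridge.mem_unramifiedSubgroup_one_iff_forall_eq_zero)
open Summit.BirchSwinnertonDyer.BirchSwinnertonDyer.Rank1Residual.LocalSplitPrime
open Summit.BirchSwinnertonDyer.BirchSwinnertonDyer.Theorems.OneSidedTwistSqueezeX9KatoDivisibilityX9KolyvaginReciprocityPkStepFour
  (toLocal_twistModPk_apply_of_mem_absInertia toLocal_tateDual_twistModPk_apply_of_mem_absInertia)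
open Summit.BirchSwinnertonDyer.BirchSwinnertonDyer.Theorems.OneSidedTwistSqueezeX9KatoDivisibilityX9ReciprocityPkSplitValues
open Summit.BirchSwinnertonDyer.BirchSwinnertonDyer.Theorems.OneSidedTwistSqueezeX9KatoDivisibilityX9KolyvaginReciprocityPkCocycle
  (pow_sub_one_smul_eq_zero_of_dvd)

section QTerm

variable {K : Type u} [Field K] [NumberField K] {p : ℕ} [Fact p.Prime] {k : ℕ}
  {M M' : Type u} [AddCommGroup M] [TopologicalSpace M] [DiscreteTopology M] [Finite M]
  [AddCommGroup M'] [TopologicalSpace M'] [DiscreteTopology M'] [Finite M']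
  (ρ : DiscreteGaloisModule K M) (ρ' : DiscreteGaloisModule K M')
  (hM : ∀ x : M, p ^ k • x = 0) (hM' : ∀ x : M', p ^ k • x = 0) (κ : ZpExtension K p) (J : ℕ)
  (q : HeightOneSpectrum (𝓞 K)) [Fact (Ideal.absNorm q.asIdeal).Prime]
  [NeZero ((Ideal.absNorm q.asIdeal : ℕ) : q.adicCompletion K)]

-- cup products on `Γ_{K_q}` need `LocallyCompactSpace`; as in the tree's `LocalTatePairing.lean`
attribute [local instance] absoluteGaloisGroup_compactSpace
omit [Finite M'] in
/-- **`tr × ur` perfectness in the twist/`B`-currency** (KOLY-MEMO §5.11.B (N3) transported along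
k6-ty's `twistDualMap : 𝒯′_J → 𝒯_J^D`, bijective for a perfect `e`): a NON-ZERO transverse class of
`𝒯_J|_q` pairs non-trivially, through any local pairing `P` with bilinear map the Gorenstein pairing,
with some UNRAMIFIED cocycle of `𝒯′_J|_q`. [cite: MazurRubin2004, Prop. 1.3.2 (p. 12)]
[cite: MilneADT2006, Ch. I, Cor. 2.3] -/
theorem exists_unramified_cupProduct_ne_zero_of_transverse_pk (hp : p ≠ 2)
    {e : M →+ M' →+ DiscreteGaloisModule.MuCarrier K (p ^ k)}
    (he : ∀ (g : absoluteGaloisGroup K) (a : M) (b : M'),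
      e (ρ g a) (ρ' g b) = DiscreteGaloisModule.mu K (p ^ k) g (e a b))
    (hnd : ∀ b : M', (∀ a : M, e a b = 0) → b = 0)
    (hsurj : ∀ χ : M →+ DiscreteGaloisModule.MuCarrier K (p ^ k), ∃ b : M', ∀ a, e a b = χ a)
    (hunr : GaloisRep.IsUnramifiedAt q ρ) (hunr' : GaloisRep.IsUnramifiedAt q ρ')
    (hqp : (p : 𝓞 K) ∉ q.asIdeal) (hpl : p ^ k ∣ Ideal.absNorm q.asIdeal - 1)
    (hχI : ∀ u : (ZMod (Ideal.absNorm q.asIdeal))ˣ, ∃ t ∈ absInertia (q.adicCompletion K),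
      modPCyclotomicCharacterZMod (q.adicCompletion K) (Ideal.absNorm q.asIdeal) t = u)
    (inv : LocalInvariants K (p ^ k)) (hperf : inv.IsPerfect)
    (P : ContPairing (GaloisRep.toLocal q (κ.twistModPk ρ hM J)).toTopRep
      (GaloisRep.toLocal q (κ.invTwist.twistModPk ρ' hM' J)).toTopRep
      ((DiscreteGaloisModule.mu K (p ^ k)).toLocal (Sum.inr q)).toTopRep)
    (hP : ∀ x y, P.toLin x y = gorensteinPairing e J x y)
    {c : galoisCohomology (GaloisRep.toLocal q (κ.twistModPk ρ hM J)) 1}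
    (hc : c ∈ DiscreteGaloisModule.transverseSubgroup (GaloisRep.toLocal q (κ.twistModPk ρ hM J))
      (CyclotomicField (Ideal.absNorm q.asIdeal) (q.adicCompletion K)))
    (hc0 : c ≠ 0) :
    ∃ ψ : contOneCocycles (GaloisRep.toLocal q (κ.invTwist.twistModPk ρ' hM' J)).toTopRep,
      (∀ t ∈ absInertia (q.adicCompletion K), ψ.1 t = 0) ∧
        inv (Sum.inr q) (P.cupProduct c (oneCocycleClass _ ψ)) ≠ 0 := by
  classical
  by_contra hcon
  have hcon' : ∀ ψ : contOneCocycles (GaloisRep.toLocal q (κ.invTwist.twistModPk ρ' hM' J)).toTopRep,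
      (∀ t ∈ absInertia (q.adicCompletion K), ψ.1 t = 0) →
        inv (Sum.inr q) (P.cupProduct c (oneCocycleClass _ ψ)) = 0 :=
    fun ψ hψ => by by_contra h; exact hcon ⟨ψ, hψ, h⟩
  have hp2 : Odd p := (Fact.out : p.Prime).odd_of_ne_two hp
  have hchar := ringChar_residueField_adicCompletion_eq q
  have hI : ∀ t ∈ absInertia (q.adicCompletion K), ∀ x : Fin J → M,
      GaloisRep.toLocal q (κ.twistModPk ρ hM J) t x = x :=
    fun _ ht x => toLocal_twistModPk_apply_of_mem_absInertia κ ρ hM J q hunr hqp ht x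
  have hI' : ∀ t ∈ absInertia (q.adicCompletion K), ∀ y : Fin J → M',
      GaloisRep.toLocal q (κ.invTwist.twistModPk ρ' hM' J) t y = y :=
    fun _ ht y => toLocal_twistModPk_apply_of_mem_absInertia κ.invTwist ρ' hM' J q hunr' hqp ht y
  have hℓM : ∀ x : Fin J → M, (Ideal.absNorm q.asIdeal - 1) • x = 0 := pow_sub_one_smul_eq_zero_of_dvd hM J hpl
  -- `D = twistDualMap` on the local modules, and its inverse
  have hDgeq : ∀ (g : absoluteGaloisGroup (q.adicCompletion K)) (y : Fin J → M'),
      κ.twistDualMapPk ρ ρ' (p ^ k) hM hM' J he (GaloisRep.toLocal q (κ.invTwist.twistModPk ρ' hM' J) g y) =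
        GaloisRep.toLocal q ((κ.twistModPk ρ hM J).tateDual (p ^ k)) g (κ.twistDualMapPk ρ ρ' (p ^ k) hM hM' J he y) :=
    fun g y => ContinuousLinearMap.ext_iff.1
      ((κ.twistDualMapPk ρ ρ' (p ^ k) hM hM' J he).isIntertwining' (absGaloisRestrict K (q.adicCompletion K) g)) y
  obtain ⟨Dl, hDlg⟩ := exists_contIntertwiningMap_of_comm
    (GaloisRep.toLocal q (κ.invTwist.twistModPk ρ' hM' J)) (GaloisRep.toLocal q ((κ.twistModPk ρ hM J).tateDual (p ^ k)))
    (κ.twistDualMapPk ρ ρ' (p ^ k) hM hM' J he).toContinuousLinearMap.toLinearMap.toAddMonoidHom (fun g y => hDgeq g y)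
  have hDl : ∀ y x, Dl y x = gorensteinPairing e J x y := fun y x => by rw [hDlg]; rfl
  have hinjD : Function.Injective (fun y => Dl y) := fun y y' hy =>
    κ.twistDualMapPk_injective ρ ρ' (p ^ k) hM hM' J he hnd ((hDlg y).symm.trans (hy.trans (hDlg y')))
  have hsurjD : Function.Surjective (fun y => Dl y) := fun z => by
    obtain ⟨y, hy⟩ := κ.twistDualMapPk_surjective ρ ρ' (p ^ k) hM hM' J he hsurj z
    exact ⟨y, (hDlg y).trans hy⟩
  have hDeq : ∀ (g : absoluteGaloisGroup (q.adicCompletion K)) (y : Fin J → M'),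
      Dl (GaloisRep.toLocal q (κ.invTwist.twistModPk ρ' hM' J) g y) =
        GaloisRep.toLocal q ((κ.twistModPk ρ hM J).tateDual (p ^ k)) g (Dl y) := fun g y => by
    rw [hDlg, hDlg]; exact hDgeq g y
  choose ginv hginv using hsurjD
  have hginv_add : ∀ z z', ginv (z + z') = ginv z + ginv z' := fun z z' =>
    hinjD (by simp only [hginv, map_add])
  obtain ⟨Dinv, hDinv⟩ := exists_contIntertwiningMap_of_comm
    (GaloisRep.toLocal q ((κ.twistModPk ρ hM J).tateDual (p ^ k))) (GaloisRep.toLocal q (κ.invTwist.twistModPk ρ' hM' J))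
    (AddMonoidHom.mk' ginv hginv_add) (fun g z => hinjD (by
      simp only [AddMonoidHom.mk'_apply, hDeq, hginv]))
  have hDD : ∀ z, Dl (Dinv z) = z := fun z => by rw [hDinv]; exact hginv z
  -- the evaluation pairing of the local modules, retyped on the `GaloisRep.toLocal` side
  obtain ⟨P₁, hP₁, hP₁lin⟩ : ∃ P₁ : ContPairing (GaloisRep.toLocal q (κ.twistModPk ρ hM J)).toTopRep
      (GaloisRep.toLocal q ((κ.twistModPk ρ hM J).tateDual (p ^ k))).toTopRep
      ((DiscreteGaloisModule.mu K (p ^ k)).toLocal (Sum.inr q)).toTopRep,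
      (∀ a b, DiscreteGaloisModule.localTatePairingZMod (κ.twistModPk ρ hM J) (p ^ k) (Sum.inr q) (inv (Sum.inr q)) a b =
        inv (Sum.inr q) (P₁.cupProduct a b)) ∧ ∀ x f, P₁.toLin x f = f x :=
    ⟨DiscreteGaloisModule.tateDualPairingLocal (κ.twistModPk ρ hM J) (p ^ k) (Sum.inr q), fun _ _ => rfl, fun _ _ => rfl⟩
  -- the local Tate pairing of `(a, D_* c')` is the `P`-cup product of `(a, c')`
  have hbridge : ∀ c' : galoisCohomology (GaloisRep.toLocal q (κ.invTwist.twistModPk ρ' hM' J)) 1,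
      DiscreteGaloisModule.localTatePairingZMod (κ.twistModPk ρ hM J) (p ^ k) (Sum.inr q) (inv (Sum.inr q)) c
        (galoisCohomology.map Dl 1 c') = inv (Sum.inr q) (P.cupProduct c c') := by
    intro c'
    rw [hP₁]
    refine congrArg (inv (Sum.inr q)) ?_
    have h := ContPairing.cupProduct_adjoint P₁ P (𝟙 _)
      (TopRep.ofHom ⟨Dl.toContinuousLinearMap, Dl.isIntertwining'⟩)
      (fun x y => by
        change P.toLin x y = P₁.toLin x (Dl y)
        rw [hP, hP₁lin, hDl]) c c'
    have h1' : (cohomologyMap (𝟙 (GaloisRep.toLocal q (κ.twistModPk ρ hM J)).toTopRep) 1) c = c := by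
      rw [show cohomologyMap (𝟙 (GaloisRep.toLocal q (κ.twistModPk ρ hM J)).toTopRep) 1 = 𝟙 _ from
        map_id_eq_id _ (fun _ => rfl) 1]
      rfl
    rw [h1'] at h
    exact h.symm
  -- every unramified class of the Tate dual pairs to zero with `c`
  have h0 : ∀ b ∈ DiscreteGaloisModule.unramifiedSubgroup (GaloisRep.toLocal q ((κ.twistModPk ρ hM J).tateDual (p ^ k))) 1,
      DiscreteGaloisModule.localTatePairingZMod (κ.twistModPk ρ hM J) (p ^ k) (Sum.inr q) (inv (Sum.inr q)) c b = 0 := by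
    intro b hb
    have hc'ur : galoisCohomology.map Dinv 1 b ∈ DiscreteGaloisModule.unramifiedSubgroup
        (GaloisRep.toLocal q (κ.invTwist.twistModPk ρ' hM' J)) 1 := map_mem_unramifiedSubgroup' _ _ Dinv hb
    have hbc : b = galoisCohomology.map Dl 1 (galoisCohomology.map Dinv 1 b) :=
      (map_map_eq_self_of_leftInverse _ _ Dl Dinv hDD b).symm
    obtain ⟨ψ', hψ'⟩ := oneCocycleClass_surjective _ (galoisCohomology.map Dinv 1 b)
    have hψ'0 : ∀ t ∈ absInertia (q.adicCompletion K), ψ'.1 t = 0 :=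
      (X11b.LocBridge.mem_unramifiedSubgroup_one_iff_forall_eq_zero _ hI' ψ').1 (by rw [hψ']; exact hc'ur)
    rw [hbc, hbridge, ← hψ']
    exact hcon' ψ' hψ'0
  have hID : ∀ t ∈ absInertia (q.adicCompletion K), ∀ f : DiscreteGaloisModule.TateDual K (Fin J → M) (p ^ k),
      GaloisRep.toLocal q ((κ.twistModPk ρ hM J).tateDual (p ^ k)) t f = f :=
    fun t ht f => toLocal_tateDual_twistModPk_apply_of_mem_absInertia κ ρ hM J q hunr hqp ht f
  have hMn : ∀ x : Fin J → M, p ^ k • x = 0 := fun x => funext fun i => by rw [Pi.smul_apply, hM, Pi.zero_apply]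
  exact hc0 (eq_zero_of_mem_transverse_of_forall_unramified_pairing_eq_zero (κ.twistModPk ρ hM J) inv q
    (Ideal.absNorm q.asIdeal) hp2.pow hperf hMn hchar hI hID hℓM hχI hc h0)

/-- **Naturality of the `tr × ur` local cup product for an `e`-adjoint pair of coordinate endomorphisms**
(KOLY-MEMO §5.11.B (N1) on classes): at an `E`-split prime every additive `φ₀ : M → M` gives an
equivariant `φ₀ ⊗ 1` on `𝒯_J|_q` (`toLocal_twistModP_comp_endo`), and for `e(φ₀ a, b) = e(a, φ₀′ b)` the
cup products of `(T^i[φ₂], [ψ₁])` and `(T^i[φ₁], [ψ₂])` agree whenever `φ₂(t₀) = φ₀ ∘ φ₁(t₀)` (transverse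
classes) and `ψ₂(Fr) = φ₀′ ∘ ψ₁(Fr)` (unramified cocycles) — by `cupProduct_adjoint`.
[cite: NeukirchSchmidtWingberg2008, I §4 (1.4.2)] [cite: MazurRubin2004, §1.3] -/
theorem cupProduct_iterate_eq_of_adjoint_pk
    {e : M →+ M' →+ DiscreteGaloisModule.MuCarrier K (p ^ k)}
    (hunr : GaloisRep.IsUnramifiedAt q ρ) (hunr' : GaloisRep.IsUnramifiedAt q ρ')
    (hqp : (p : 𝓞 K) ∉ q.asIdeal) (hpl : p ^ k ∣ Ideal.absNorm q.asIdeal - 1)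
    (hχI : ∀ u : (ZMod (Ideal.absNorm q.asIdeal))ˣ, ∃ t ∈ absInertia (q.adicCompletion K),
      modPCyclotomicCharacterZMod (q.adicCompletion K) (Ideal.absNorm q.asIdeal) t = u)
    {Fr : absoluteGaloisGroup (q.adicCompletion K)} (hFr : IsAbsArithFrob Fr)
    (hsplit : ρ (absGaloisRestrict K (q.adicCompletion K) Fr) = 1)
    (hsplit' : ρ' (absGaloisRestrict K (q.adicCompletion K) Fr) = 1)
    {t₀ : absoluteGaloisGroup (q.adicCompletion K)} (ht₀ : t₀ ∈ absInertia (q.adicCompletion K))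
    (hgen : ∀ u : (ZMod (Ideal.absNorm q.asIdeal))ˣ,
      u ∈ Subgroup.zpowers (modPCyclotomicCharacterZMod (q.adicCompletion K) (Ideal.absNorm q.asIdeal) t₀))
    (P : ContPairing (GaloisRep.toLocal q (κ.twistModPk ρ hM J)).toTopRep
      (GaloisRep.toLocal q (κ.invTwist.twistModPk ρ' hM' J)).toTopRep
      ((DiscreteGaloisModule.mu K (p ^ k)).toLocal (Sum.inr q)).toTopRep)
    (hP : ∀ x y, P.toLin x y = gorensteinPairing e J x y)
    (S : (GaloisRep.toLocal q (κ.twistModPk ρ hM J)).toContRepresentation →ⁱL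
      (GaloisRep.toLocal q (κ.twistModPk ρ hM J)).toContRepresentation)
    (hS : ∀ x, S x = shiftEnd M J x)
    (φ₀ : M →+ M) (φ₀' : M' →+ M') (hadj : ∀ a b, e (φ₀ a) b = e a (φ₀' b))
    (φ₁ φ₂ : contOneCocycles (GaloisRep.toLocal q (κ.twistModPk ρ hM J)).toTopRep)
    (hφ₁ : oneCocycleClass _ φ₁ ∈ DiscreteGaloisModule.transverseSubgroup (GaloisRep.toLocal q (κ.twistModPk ρ hM J))
        (CyclotomicField (Ideal.absNorm q.asIdeal) (q.adicCompletion K)))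
    (hφ₂ : oneCocycleClass _ φ₂ ∈ DiscreteGaloisModule.transverseSubgroup (GaloisRep.toLocal q (κ.twistModPk ρ hM J))
        (CyclotomicField (Ideal.absNorm q.asIdeal) (q.adicCompletion K)))
    (hφ : φ₂.1 t₀ = fun j => φ₀ (φ₁.1 t₀ j))
    (ψ₁ ψ₂ : contOneCocycles (GaloisRep.toLocal q (κ.invTwist.twistModPk ρ' hM' J)).toTopRep)
    (hψ₁ : ∀ t ∈ absInertia (q.adicCompletion K), ψ₁.1 t = 0)
    (hψ₂ : ∀ t ∈ absInertia (q.adicCompletion K), ψ₂.1 t = 0)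
    (hψ : ψ₂.1 Fr = fun j => φ₀' (ψ₁.1 Fr j)) (i : ℕ) :
    P.cupProduct ((galoisCohomology.map S 1)^[i] (oneCocycleClass _ φ₂)) (oneCocycleClass _ ψ₁) =
      P.cupProduct ((galoisCohomology.map S 1)^[i] (oneCocycleClass _ φ₁)) (oneCocycleClass _ ψ₂) := by
  classical
  have hFr1 : IsFrobPow Fr 1 := IsAbsArithFrob.isFrobPow_holds hFr
  have hI' : ∀ t ∈ absInertia (q.adicCompletion K), ∀ y : Fin J → M',
      GaloisRep.toLocal q (κ.invTwist.twistModPk ρ' hM' J) t y = y :=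
    fun _ ht y => toLocal_twistModPk_apply_of_mem_absInertia κ.invTwist ρ' hM' J q hunr' hqp ht y
  have hI'1 : ∀ t ∈ absInertia (q.adicCompletion K), GaloisRep.toLocal q (κ.invTwist.twistModPk ρ' hM' J) t = 1 :=
    fun t ht => LinearMap.ext (hI' t ht)
  have htrivM : ∀ (g : absoluteGaloisGroup (q.adicCompletion K)) (a : M), GaloisRep.toLocal q ρ g a = a :=
    toLocal_apply_eq_self_of_split ρ q hunr hFr1 hsplit
  have htrivM' : ∀ (g : absoluteGaloisGroup (q.adicCompletion K)) (b : M'), GaloisRep.toLocal q ρ' g b = b :=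
    toLocal_apply_eq_self_of_split ρ' q hunr' hFr1 hsplit'
  obtain ⟨A, hA⟩ := exists_contIntertwiningMap_of_comm
    (GaloisRep.toLocal q (κ.twistModPk ρ hM J)) (GaloisRep.toLocal q (κ.twistModPk ρ hM J))
    (φ₀.compLeft (Fin J))
    (fun g x => (toLocal_twistModPk_comp_endo ρ hM κ J q htrivM φ₀ g x).symm)
  obtain ⟨A', hA'⟩ := exists_contIntertwiningMap_of_comm
    (GaloisRep.toLocal q (κ.invTwist.twistModPk ρ' hM' J)) (GaloisRep.toLocal q (κ.invTwist.twistModPk ρ' hM' J))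
    (φ₀'.compLeft (Fin J))
    (fun g y => (toLocal_twistModPk_comp_endo ρ' hM' κ.invTwist J q htrivM' φ₀' g y).symm)
  -- `T^i (H¹(A)[φ₁]) = T^i [φ₂]`: both transverse with the same value at `t₀`
  have hSit : ∀ (n : ℕ) (v : Fin J → M), (fun x => S x)^[n] v = (shiftEnd M J ^ n) v := by
    intro n v
    induction n with
    | zero => simp
    | succ n ih => rw [Function.iterate_succ_apply', ih, hS, pow_succ', Module.End.mul_apply]
  have hXA : (galoisCohomology.map S 1)^[i] (galoisCohomology.map A 1 (oneCocycleClass _ φ₁)) =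
      (galoisCohomology.map S 1)^[i] (oneCocycleClass _ φ₂) := by
    obtain ⟨φ', h1, h2⟩ := galoisCohomology_map_oneCocycleClass _ _ A φ₁
    obtain ⟨φ'', h1', h2'⟩ := map_iterate_oneCocycleClass _ S i φ'
    obtain ⟨φ₂', h1₂, h2₂⟩ := map_iterate_oneCocycleClass _ S i φ₂
    rw [h2, h2', h2₂]
    refine oneCocycleClass_eq_of_transverse_of_apply_eq_pk ρ hM κ J q hunr hqp hpl hχI ht₀ hgen φ'' φ₂' ?_ ?_ ?_
    · rw [← h2']; refine iterate_map_mem_transverseSubgroup _ _ S i ?_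
      rw [← h2]; exact map_mem_transverseSubgroup _ _ _ A hφ₁
    · rw [← h2₂]; exact iterate_map_mem_transverseSubgroup _ _ S i hφ₂
    · rw [h1', h1₂, hSit, hSit, h1, hA, hφ]
      rfl
  have hYA : galoisCohomology.map A' 1 (oneCocycleClass _ ψ₁) = oneCocycleClass _ ψ₂ := by
    obtain ⟨ψ', h1, h2⟩ := galoisCohomology_map_oneCocycleClass _ _ A' ψ₁
    rw [h2]
    refine oneCocycleClass_eq_of_unramified_of_apply_frob_sub_mem _ hI'1 hFr ψ' ψ₂ ?_ hψ₂ (m := 0) ?_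
    · intro t ht; rw [h1, hψ₁ t ht, map_zero]
    · rw [h1, hψ, hA', map_zero, sub_zero, sub_eq_zero]; rfl
  have hcupA : ∀ (a : galoisCohomology (GaloisRep.toLocal q (κ.twistModPk ρ hM J)) 1)
      (b : galoisCohomology (GaloisRep.toLocal q (κ.invTwist.twistModPk ρ' hM' J)) 1),
      P.cupProduct (galoisCohomology.map A 1 a) b = P.cupProduct a (galoisCohomology.map A' 1 b) := by
    intro a b
    exact ContPairing.cupProduct_adjoint P P
      (TopRep.ofHom ⟨A.toContinuousLinearMap, A.isIntertwining'⟩)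
      (TopRep.ofHom ⟨A'.toContinuousLinearMap, A'.isIntertwining'⟩)
      (fun x y => by
        change P.toLin (A x) y = P.toLin x (A' y)
        rw [hP, hP, hA, hA']
        exact gorensteinPairing_comp_adjoint e hadj x y) a b
  -- `T^i` commutes with `H¹(A)` (both are `H¹` of equivariant maps commuting on `𝒯_J`)
  have hSA : ∀ c : galoisCohomology (GaloisRep.toLocal q (κ.twistModPk ρ hM J)) 1,
      (galoisCohomology.map S 1)^[i] (galoisCohomology.map A 1 c) =
        galoisCohomology.map A 1 ((galoisCohomology.map S 1)^[i] c) := by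
    intro c
    obtain ⟨φ, rfl⟩ := oneCocycleClass_surjective _ c
    obtain ⟨φa, h1, h2⟩ := galoisCohomology_map_oneCocycleClass _ _ A φ
    obtain ⟨φas, h1', h2'⟩ := map_iterate_oneCocycleClass _ S i φa
    obtain ⟨φs, h1s, h2s⟩ := map_iterate_oneCocycleClass _ S i φ
    obtain ⟨φsa, h1sa, h2sa⟩ := galoisCohomology_map_oneCocycleClass _ _ A φs
    rw [h2, h2', h2s, h2sa]
    congr 1
    refine Subtype.ext (ContinuousMap.ext fun g => ?_)
    rw [h1', h1sa, hSit, h1, h1s, hSit, hA, hA]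
    exact shiftEnd_pow_comp_apply φ₀ i _
  rw [← hXA, hSA, hcupA, hYA]

end QTerm

end Summit.BirchSwinnertonDyer.BirchSwinnertonDyer.Theorems.OneSidedTwistSqueezeX9KatoDivisibilityX9ReciprocityPkNaturality

end
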